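/-
Copyright (c) 2026 the pub-hodgecm-mathlib formalisation cell (harness21).  Prover seat hodgecm-mathlib-K2E3-p17 (g11), HCML Track B «K2-LIT» ∕ h413
(`stmt-HodgeConjecture-24833`), R90-TF section S3, (U3-F) assembly layer B2 §5 «the LOCAL TARGET `H = h·∏(X − cᵢ)` with PINNED constant term» (dealer
R90-C12-plan (g2) 01:14:10Z «YES to §5 exists_localTarget»).  2026-09-05.
-/
import Summits.HodgeConjecture.HodgeConjecture.Theorems.R90S3LocalPlantingDatum   -- ★ B2: `exists_localPlantingDatum`
import HarnessLib

/-!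
# R90-TF · S3 · THEOREMS — `R90S3LocalTarget` ((U3-F) assembly, layer B2 §5): the p-adic PLANTING TARGET `H := h₀·∏ᵢ (X − cᵢ) ∈ ℤ_p[X]` — monic of degree
# `[K:ℚ_p] + r`, SEPARABLE over `ℚ_p`, with the generator `y = m s²` as a root, `r` distinct UNIT roots `cᵢ`, and constant term EXACTLY `p^a` (`a ≥ 1`)

R90-TF section S3 (dealer R90-C12-plan (g2)); crux H413 (`stmt-HodgeConjecture-24833`, lane `--supports … --as helper`), route `HCCMUnconditional`.  Packages ★ B2
`R90S3LocalPlantingDatum.exists_localPlantingDatum` (K2E3-p17) into the single polynomial the planting step consumes (census (C0): the constant term of the planted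
`g ∈ ℤ[X]` is PINNED to `pᵃ`, and the p-adic target must have the SAME constant term for the coefficientwise congruence `g ≡ H (mod p^N)` to hold at `i = 0`).
Consumers: ★ B4a `R90S3PlantingTargets` (K2E3-p21; `H` read mod `p^N` by `PadicInt.toZModPow`), B6 `R90S3PlantedRootsAndPlaces` (K2E4-p14; Krasner ★
`KrasnerLocallyConstant.adjoin_eq_adjoin_of_coeff_near` around the roots `ι y` and `cᵢ` of the separable `H`).  ★∕Mathlib-only imports; THEOREMS ONLY (no `def`, no
`instance`, no notation, no named fact, no `sorry`); never imports `Cruxes/…/Lines`.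

THE MATHEMATICS [folklore].  With `(y, s, h₀, c)` from ★ B2 at the prescribed product `t := (−1)^r · u⁻¹`, where `h₀(0) = u · p^a` (`u ∈ ℤ_p^×`, `a = v_p(h₀(0))`, Mathlib
`PadicInt.unitCoeff_spec`; `a ≥ 1` since `‖h₀(0)‖ < 1`; `h₀(0) ≠ 0` as the constant term of a minimal polynomial of `y ≠ 0`): `H := h₀ · ∏ (X − C cᵢ)` is monic of degree
`d₀ + r`, `H(0) = h₀(0) · ∏(−cᵢ) = u p^a · (−1)^r t = p^a`; over `ℚ_p`, `H = minpoly(y) · ∏ (X − cᵢ)` is SEPARABLE: `minpoly y` is irreducible in characteristic `0`, the `cᵢ` are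
distinct, and `minpoly y` is coprime to each `X − cᵢ` because a unit `cᵢ` is not a root of `h₀` (★ B2 `not_isRoot_of_isUnit_of_coeff_norm_lt_one`).
* `valuation_coeff_zero_pos` (`a ≥ 1`), `coeff_zero_mul_prod_X_sub_C`, `separable_minpoly_mul_prod_X_sub_C`, **`exists_localTarget`** (the head).

HONEST LABEL: HC_CM is proved only modulo the 7 printed citations (2 remaining named inputs: hLiu418 = stmt-HodgeConjecture-24832, h413 =
stmt-HodgeConjecture-24833) until rung 0 closes; local algebra for a sub-step of a GENUINE residual ((U3-F)); proves nothing printed; count-neutral.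
References: [NeukirchANT1999] Ch. II (8.2)–(8.4); [Gouvea1993PadicNumbers] Cor. 6.8.3 (the Krasner consumer).
-/

set_option autoImplicit false
-- the mandated namespace repeats the single-problem summit's segment (`HodgeConjecture.HodgeConjecture`)
set_option linter.dupNamespace false

noncomputable section

namespace Summit.HodgeConjecture.HodgeConjecture.R90.S3

open Polynomial IntermediateField IsDedekindDomain NumberField

variable (p : ℕ) [Fact p.Prime]

/-- A non-zero `x ∈ ℤ_p` of norm `< 1` has valuation `≥ 1`. [folklore] -/
theorem one_le_valuation_of_norm_lt_one {x : ℤ_[p]} (hx : x ≠ 0) (hlt : ‖x‖ < 1) : 1 ≤ x.valuation := by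
  by_contra h
  have h0 : x.valuation = 0 := by omega
  have : ‖x‖ = 1 := by rw [PadicInt.norm_eq_zpow_neg_valuation hx, h0]; simp
  linarith

/-- The constant term of `h₀ · ∏ (X − C cᵢ)` is `h₀(0) · ∏ (−cᵢ)`. [folklore] -/
theorem coeff_zero_mul_prod_X_sub_C {R : Type*} [CommRing R] {r : ℕ} (h₀ : R[X]) (c : Fin r → R) :
    (h₀ * ∏ i, (X - C (c i))).coeff 0 = h₀.coeff 0 * ∏ i, (-c i) := by
  rw [mul_coeff_zero, coeff_zero_prod]
  simp

/-- **Separability of `minpoly(y) · ∏ (X − cᵢ)` over a field of characteristic `0`**: distinct `cᵢ`, none a root of `minpoly y`. [folklore] -/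
theorem separable_minpoly_mul_prod_X_sub_C {F K : Type*} [Field F] [CharZero F] [Field K] [Algebra F K] {y : K} (hy : IsIntegral F y) {r : ℕ}
    (c : Fin r → F) (hc : Function.Injective c) (hroot : ∀ i, ¬ (minpoly F y).IsRoot (c i)) :
    (minpoly F y * ∏ i, (X - C (c i))).Separable := by
  refine (minpoly.irreducible hy).separable.mul (separable_prod_X_sub_C_iff.2 hc) ?_
  refine IsCoprime.prod_right fun i _ => ?_
  -- `minpoly y` and `X − cᵢ` are coprime since `cᵢ` is not a root
  refine ((irreducible_X_sub_C (c i)).coprime_iff_not_dvd.2 ?_).symm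
  rw [dvd_iff_isRoot]
  exact hroot i

section Target

variable {L : Type} [Field L] [NumberField L] (w : HeightOneSpectrum (𝓞 L))
  [Algebra ℚ_[p] (w.adicCompletion L)] [FiniteDimensional ℚ_[p] (w.adicCompletion L)]

/-- **THE LOCAL TARGET (B2 §5).**  At `K = L_w` with a continuous finite `ℚ_p`-structure and `ι : K →ₐ[ℚ_p] Q̄_p`, for `m ≠ 0` and `r ∈ {1,2,3}`: a non-zero GENERATOR
`y = m s²` and a monic `H ∈ ℤ_p[X]` of degree `[K:ℚ_p] + r` with `H(0) = p^a` EXACTLY (`a ≥ 1`), whose image in `ℚ_p[X]` is `minpoly(y) · ∏ᵢ (X − cᵢ)` for `r` DISTINCT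
UNITS `cᵢ ∈ ℤ_p^×` — hence separable, with roots `y` and the `cᵢ`. [cite: NeukirchANT1999, Ch. II (8.2)-(8.4)] [cite: Gouvea1993PadicNumbers, Cor. 6.8.3] -/
theorem exists_localTarget (hc : Continuous (algebraMap ℚ_[p] (w.adicCompletion L))) (ι : w.adicCompletion L →ₐ[ℚ_[p]] PadicAlgCl p)
    {m : w.adicCompletion L} (hm : m ≠ 0) (r : ℕ) (hr1 : 1 ≤ r) (hr3 : r ≤ 3) :
    ∃ (y s : w.adicCompletion L) (H : ℤ_[p][X]) (c : Fin r → ℤ_[p]) (a : ℕ),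
      y ≠ 0 ∧ y = m * s ^ 2 ∧ ℚ_[p]⟮y⟯ = ⊤ ∧
      H.Monic ∧ H.natDegree = Module.finrank ℚ_[p] (w.adicCompletion L) + r ∧ H.coeff 0 = (p : ℤ_[p]) ^ a ∧ 1 ≤ a ∧
      H.map (algebraMap ℤ_[p] ℚ_[p]) = minpoly ℚ_[p] y * ∏ i, (X - C (c i : ℚ_[p])) ∧
      (H.map (algebraMap ℤ_[p] ℚ_[p])).Separable ∧ aeval y (H.map (algebraMap ℤ_[p] ℚ_[p])) = 0 ∧
      (∀ i, IsUnit (c i)) ∧ Function.Injective c ∧ (∀ i, (H.map (algebraMap ℤ_[p] ℚ_[p])).IsRoot (c i : ℚ_[p])) := by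
  -- the generator and `h₀` from ★ B2 (its unit-root clause is not used here: the prescribed product `t` depends on `h₀(0)`, so the unit roots are taken
  -- afterwards from ★ B2 `exists_units_injective_prod_eq` at `t := (−1)^r u⁻¹`)
  obtain ⟨y, s, h₀, -, hy, hys, hgen, hm₀, hdeg, hmap, hlow, hnoroot, -, -, -⟩ := exists_localPlantingDatum p w hc ι hm r hr1 hr3 1
  have hint : IsIntegral ℚ_[p] y := IsIntegral.of_finite ℚ_[p] y
  -- `h₀(0) = u · p^a`, `a ≥ 1`
  have h00 : h₀.coeff 0 ≠ 0 := by
    intro h0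
    apply minpoly.coeff_zero_ne_zero hint hy
    rw [← hmap, coeff_map, h0, map_zero]
  have hd0 : 0 < h₀.natDegree := by
    rw [hdeg]; exact Module.finrank_pos
  set a : ℕ := (h₀.coeff 0).valuation with hadef
  set u : ℤ_[p]ˣ := PadicInt.unitCoeff h00 with hudef
  have hspec : h₀.coeff 0 = (u : ℤ_[p]) * (p : ℤ_[p]) ^ a := PadicInt.unitCoeff_spec h00
  have ha1 : 1 ≤ a := one_le_valuation_of_norm_lt_one p h00 (hlow 0 hd0)
  -- the unit roots with product `t := (−1)^r u⁻¹`
  set t : ℤ_[p]ˣ := (-1) ^ r * u⁻¹ with htdef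
  obtain ⟨c, hcu, hci, hcp⟩ := exists_units_injective_prod_eq p t r hr1 hr3
  -- the target
  set H : ℤ_[p][X] := h₀ * ∏ i, (X - C (c i)) with hHdef
  have hprodm : (∏ i : Fin r, (X - C (c i))).Monic := monic_prod_of_monic _ _ fun i _ => monic_X_sub_C (c i)
  have hHm : H.Monic := hm₀.mul hprodm
  have hHdeg : H.natDegree = Module.finrank ℚ_[p] (w.adicCompletion L) + r := by
    rw [hHdef, hm₀.natDegree_mul hprodm, hdeg, natDegree_prod_of_monic _ _ fun i _ => monic_X_sub_C (c i)]
    simp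
  have hH0 : H.coeff 0 = (p : ℤ_[p]) ^ a := by
    rw [hHdef, coeff_zero_mul_prod_X_sub_C, hspec]
    have hneg : ∏ i : Fin r, (-c i) = (-1) ^ r * ∏ i, c i := by
      rw [Finset.prod_neg (f := c) ]; simp
    rw [hneg, hcp, htdef]
    push_cast
    have hu : (u : ℤ_[p]) * ↑u⁻¹ = 1 := Units.mul_inv u
    have h1 : ((-1 : ℤ_[p]) ^ r) * (-1) ^ r = 1 := by rw [← mul_pow, neg_one_mul, neg_neg, one_pow]
    linear_combination ((p : ℤ_[p]) ^ a) * ((-1 : ℤ_[p]) ^ r * (-1) ^ r) * hu + ((p : ℤ_[p]) ^ a) * h1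
  have hHmap : H.map (algebraMap ℤ_[p] ℚ_[p]) = minpoly ℚ_[p] y * ∏ i, (X - C (c i : ℚ_[p])) := by
    rw [hHdef, Polynomial.map_mul, hmap, Polynomial.map_prod]
    simp [PadicInt.algebraMap_apply]
  -- roots in `ℚ_p` of the unit centres and separability
  have hci' : Function.Injective fun i => (c i : ℚ_[p]) := fun i j h => hci (Subtype.val_injective h)  -- injectivity of the coercion
  have hroot' : ∀ i, ¬ (minpoly ℚ_[p] y).IsRoot (c i : ℚ_[p]) := by
    intro i hri
    apply hnoroot (c i) (hcu i)
    rw [← hmap, ← PadicInt.algebraMap_apply, isRoot_map_iff (IsFractionRing.injective ℤ_[p] ℚ_[p])] at hri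
    exact hri
  have hsep : (H.map (algebraMap ℤ_[p] ℚ_[p])).Separable := by
    rw [hHmap]; exact separable_minpoly_mul_prod_X_sub_C hint (fun i => (c i : ℚ_[p])) hci' hroot'
  have haeval : aeval y (H.map (algebraMap ℤ_[p] ℚ_[p])) = 0 := by
    rw [hHmap, map_mul, minpoly.aeval, zero_mul]
  have hroots : ∀ i, (H.map (algebraMap ℤ_[p] ℚ_[p])).IsRoot (c i : ℚ_[p]) := by
    intro i
    rw [hHmap, IsRoot, eval_mul, eval_prod, Finset.prod_eq_zero (Finset.mem_univ i) (by simp), mul_zero]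
  exact ⟨y, s, H, c, a, hy, hys, hgen, hHm, hHdeg, hH0, ha1, hHmap, hsep, haeval, hcu, hci, hroots⟩

/-! ## §6 (ED. 2) The exponent `a` FIXED BEFORE the number `r` of extra unit roots is chosen — so the consumer can meet C1 `4 ∣ (−1)^(n+r) p^a − 1` -/

/-- **THE LOCAL TARGET, `a` BEFORE `r` (ED. 2).**  As `exists_localTarget`, but the generator `y = m s²` and the exponent `a ≥ 1` (with `H(0) = p^a`) are produced FIRST,
and THEN, for every `r ∈ {1,2,3}`, a monic `H ∈ ℤ_p[X]` of degree `[K:ℚ_p] + r` with `H(0) = p^a`, image `minpoly(y) · ∏ (X − cᵢ)` for `r` distinct units `cᵢ`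
(roots of `H` in `ℤ_p`), separable; together with the low-coefficient bound `‖coeffᵢ (minpoly y)‖ < 1` (`i < deg`) that gives `‖ι y‖ < 1`.
[cite: NeukirchANT1999, Ch. II (8.2)-(8.4)] [cite: Gouvea1993PadicNumbers, Cor. 6.8.3] -/
theorem exists_localTarget_forall (hc : Continuous (algebraMap ℚ_[p] (w.adicCompletion L))) (ι : w.adicCompletion L →ₐ[ℚ_[p]] PadicAlgCl p)
    {m : w.adicCompletion L} (hm : m ≠ 0) :
    ∃ (y s : w.adicCompletion L) (a : ℕ), y ≠ 0 ∧ y = m * s ^ 2 ∧ ℚ_[p]⟮y⟯ = ⊤ ∧ 1 ≤ a ∧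
      (∀ i, i < (minpoly ℚ_[p] y).natDegree → ‖(minpoly ℚ_[p] y).coeff i‖ < 1) ∧
      ∀ r : ℕ, 1 ≤ r → r ≤ 3 → ∃ (H : ℤ_[p][X]) (c : Fin r → ℤ_[p]),
        H.Monic ∧ H.natDegree = Module.finrank ℚ_[p] (w.adicCompletion L) + r ∧ H.coeff 0 = (p : ℤ_[p]) ^ a ∧
        H.map (algebraMap ℤ_[p] ℚ_[p]) = minpoly ℚ_[p] y * ∏ i, (X - C (c i : ℚ_[p])) ∧
        (H.map (algebraMap ℤ_[p] ℚ_[p])).Separable ∧ aeval y (H.map (algebraMap ℤ_[p] ℚ_[p])) = 0 ∧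
        (∀ i, IsUnit (c i)) ∧ Function.Injective c ∧ (∀ i, (H.map (algebraMap ℤ_[p] ℚ_[p])).IsRoot (c i : ℚ_[p])) ∧
        (∀ i, H.IsRoot (c i)) := by
  obtain ⟨y, s, h₀, -, hy, hys, hgen, hm₀, hdeg, hmap, hlow, hnoroot, -, -, -⟩ := exists_localPlantingDatum p w hc ι hm 1 le_rfl (by norm_num) 1
  have hint : IsIntegral ℚ_[p] y := IsIntegral.of_finite ℚ_[p] y
  -- `h₀(0) = u · p^a`, `a ≥ 1`
  have h00 : h₀.coeff 0 ≠ 0 := by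
    intro h0
    apply minpoly.coeff_zero_ne_zero hint hy
    rw [← hmap, coeff_map, h0, map_zero]
  have hd0 : 0 < h₀.natDegree := by
    rw [hdeg]; exact Module.finrank_pos
  set a : ℕ := (h₀.coeff 0).valuation with hadef
  set u : ℤ_[p]ˣ := PadicInt.unitCoeff h00 with hudef
  have hspec : h₀.coeff 0 = (u : ℤ_[p]) * (p : ℤ_[p]) ^ a := PadicInt.unitCoeff_spec h00
  have ha1 : 1 ≤ a := one_le_valuation_of_norm_lt_one p h00 (hlow 0 hd0)
  -- the low coefficients of `minpoly y = h₀ ⊗ ℚ_p`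
  have hdegm : (minpoly ℚ_[p] y).natDegree = h₀.natDegree := by
    rw [← hmap, hm₀.natDegree_map]
  have hlow' : ∀ i, i < (minpoly ℚ_[p] y).natDegree → ‖(minpoly ℚ_[p] y).coeff i‖ < 1 := by
    intro i hi
    rw [← hmap, coeff_map, PadicInt.algebraMap_apply, PadicInt.padic_norm_e_of_padicInt]
    exact hlow i (hdegm ▸ hi)
  refine ⟨y, s, a, hy, hys, hgen, ha1, hlow', fun r hr1 hr3 => ?_⟩
  -- the unit roots with product `t := (−1)^r u⁻¹`
  set t : ℤ_[p]ˣ := (-1) ^ r * u⁻¹ with htdef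
  obtain ⟨c, hcu, hci, hcp⟩ := exists_units_injective_prod_eq p t r hr1 hr3
  -- the target
  set H : ℤ_[p][X] := h₀ * ∏ i, (X - C (c i)) with hHdef
  have hprodm : (∏ i : Fin r, (X - C (c i))).Monic := monic_prod_of_monic _ _ fun i _ => monic_X_sub_C (c i)
  have hHm : H.Monic := hm₀.mul hprodm
  have hHdeg : H.natDegree = Module.finrank ℚ_[p] (w.adicCompletion L) + r := by
    rw [hHdef, hm₀.natDegree_mul hprodm, hdeg, natDegree_prod_of_monic _ _ fun i _ => monic_X_sub_C (c i)]
    simp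
  have hH0 : H.coeff 0 = (p : ℤ_[p]) ^ a := by
    rw [hHdef, coeff_zero_mul_prod_X_sub_C, hspec]
    have hneg : ∏ i : Fin r, (-c i) = (-1) ^ r * ∏ i, c i := by
      rw [Finset.prod_neg (f := c) ]; simp
    rw [hneg, hcp, htdef]
    push_cast
    have hu : (u : ℤ_[p]) * ↑u⁻¹ = 1 := Units.mul_inv u
    have h1 : ((-1 : ℤ_[p]) ^ r) * (-1) ^ r = 1 := by rw [← mul_pow, neg_one_mul, neg_neg, one_pow]
    linear_combination ((p : ℤ_[p]) ^ a) * ((-1 : ℤ_[p]) ^ r * (-1) ^ r) * hu + ((p : ℤ_[p]) ^ a) * h1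
  have hHmap : H.map (algebraMap ℤ_[p] ℚ_[p]) = minpoly ℚ_[p] y * ∏ i, (X - C (c i : ℚ_[p])) := by
    rw [hHdef, Polynomial.map_mul, hmap, Polynomial.map_prod]
    simp [PadicInt.algebraMap_apply]
  -- roots of the unit centres (in `ℤ_p` and in `ℚ_p`) and separability
  have hci' : Function.Injective fun i => (c i : ℚ_[p]) := fun i j h => hci (Subtype.val_injective h)  -- injectivity of the coercion
  have hroot' : ∀ i, ¬ (minpoly ℚ_[p] y).IsRoot (c i : ℚ_[p]) := by
    intro i hri
    apply hnoroot (c i) (hcu i)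
    rw [← hmap, ← PadicInt.algebraMap_apply, isRoot_map_iff (IsFractionRing.injective ℤ_[p] ℚ_[p])] at hri
    exact hri
  have hsep : (H.map (algebraMap ℤ_[p] ℚ_[p])).Separable := by
    rw [hHmap]; exact separable_minpoly_mul_prod_X_sub_C hint (fun i => (c i : ℚ_[p])) hci' hroot'
  have haeval : aeval y (H.map (algebraMap ℤ_[p] ℚ_[p])) = 0 := by
    rw [hHmap, map_mul, minpoly.aeval, zero_mul]
  have hrootsZ : ∀ i, H.IsRoot (c i) := by
    intro i
    rw [hHdef, IsRoot, eval_mul, eval_prod, Finset.prod_eq_zero (Finset.mem_univ i) (by simp), mul_zero]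
  have hroots : ∀ i, (H.map (algebraMap ℤ_[p] ℚ_[p])).IsRoot (c i : ℚ_[p]) := by
    intro i
    rw [← PadicInt.algebraMap_apply, isRoot_map_iff (IsFractionRing.injective ℤ_[p] ℚ_[p])]
    exact hrootsZ i
  exact ⟨H, c, hHm, hHdeg, hH0, hHmap, hsep, haeval, hcu, hci, hroots, hrootsZ⟩

end Target

/-! ## §7 (ED. 2) The chooser of `r`: parity (C1) and `d = n + r ≥ 3` -/

/-- **C1 CHOOSER.**  For `p` odd, `a n : ℕ` with `n ≥ 1` there is `r ∈ {1,2,3}` with `n + r ≥ 3` and `(−1)^(n+r) p^a ≡ 1 (mod 4)` (so the dyadic target of ★ B4b∕TargetList,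
whose roots are `≡ 1 (mod 4)`, can carry the pinned constant `p^a`). [folklore] -/
theorem exists_extra_root_count {p : ℕ} (hp : Odd p) (a n : ℕ) (hn : 1 ≤ n) :
    ∃ r : ℕ, 1 ≤ r ∧ r ≤ 3 ∧ 3 ≤ n + r ∧ (4 : ℤ) ∣ (-1) ^ (n + r) * (p : ℤ) ^ a - 1 := by
  have hpZ : Odd (p : ℤ) := by
    obtain ⟨k, hk⟩ := hp
    exact ⟨k, by exact_mod_cast hk⟩
  have hq : ((p : ℤ) ^ a) % 2 = 1 := Int.odd_iff.mp (hpZ.pow)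
  have hq4 : ((p : ℤ) ^ a) % 4 = 1 ∨ ((p : ℤ) ^ a) % 4 = 3 := by omega
  -- pick the parity of `n + r` according to `p^a mod 4`, with `n + r ≥ 3`
  rcases Nat.even_or_odd n with hne | hno
  · rcases hq4 with h1 | h3
    · -- `n` even, need `n + r` even: `r = 2`
      refine ⟨2, by norm_num, by norm_num, by obtain ⟨k, hk⟩ := hne; omega, ?_⟩
      have he : Even (n + 2) := by obtain ⟨k, hk⟩ := hne; exact ⟨k + 1, by omega⟩
      rw [he.neg_one_pow, one_mul]; omega
    · -- `n` even, need `n + r` odd: `r = 1`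
      refine ⟨1, le_rfl, by norm_num, by obtain ⟨k, hk⟩ := hne; omega, ?_⟩
      have ho : Odd (n + 1) := by obtain ⟨k, hk⟩ := hne; exact ⟨k, by omega⟩
      rw [ho.neg_one_pow, neg_one_mul]; omega
  · rcases hq4 with h1 | h3
    · -- `n` odd, need `n + r` even: `r = 3`
      refine ⟨3, by norm_num, le_rfl, by omega, ?_⟩
      have he : Even (n + 3) := by obtain ⟨k, hk⟩ := hno; exact ⟨k + 2, by omega⟩
      rw [he.neg_one_pow, one_mul]; omega
    · -- `n` odd, need `n + r` odd: `r = 2`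
      refine ⟨2, by norm_num, by norm_num, by omega, ?_⟩
      have ho : Odd (n + 2) := by obtain ⟨k, hk⟩ := hno; exact ⟨k + 1, by omega⟩
      rw [ho.neg_one_pow, neg_one_mul]; omega

end Summit.HodgeConjecture.HodgeConjecture.R90.S3

end
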